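import Summits.Ventures.HSemireg.WedgeHankelRecurrenceCensus

/-!
# Venture HSemireg — THE CENSUS WITH A PRESCRIBED PREFIX: fix the first `k` coefficients `a = (v_0, …, v_{k−1})` of a class on `[0, N]` over a finite field with `s` elements; then for
# **`k ≤ r` and `2r ≤ N + 1`, exactly `s^{2r−k}` of the `s^{N+1−k}` classes with prefix `a` have middle rank `R^N ≤ r` — whatever `a` is** (Dwivedi–Grinberg 2022, Theorem 2, the
# question of Scholze; here a corollary of the transition table of N43/N44: the counts of polar classes satisfy `P_N(r) = (s − 1)·#{R^N < r}` as soon as `r + k ≤ N + 1`, which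
# makes `#{R^N ≤ r}` independent of the level `N ≥ 2r − 1`, where it is everything)

HONEST FRAMING. Part of the Lean index of the computation cell `pub-hsemireg` (seat p10 gen 28, Sunday typer «UNIFORM-IN-n»).
LINEAR ALGEBRA OF HANKEL (catalecticant) MATRICES over a field ONLY: no variety, no cohomology theory, no sheaf, no Ext group and no semiregularity map is constructed here; nothing here
says that HC / HC_CM / HC_AV holds; no Literature fact is declared or used.  Custodian versions as in `WedgeHankelSiegelIdeal` (1/3).  READING (not used): O. D. Dwivedi, D. Grinberg,
«On the rank of Hankel matrices over finite fields», Linear Algebra Appl. (2022), arXiv:2109.05415, Theorem 2 (p. 2: «The existence of such a generalization was suggested to us by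
Peter Scholze»): for `k ≤ r ≤ m`, `r ≤ n` and any `a ∈ F^k`, `#{x ∈ F^{m+n+1} : x_{[0,k)} = a, rank H_{m,n}(x) ≤ r} = q^{2r−k}`; their proof is by a different (bijective ∕ linear-algebraic)
argument.  Here: the middle shape (`m = ⌊N/2⌋`), which carries every shape by N15's trapezoid law as in N44 §548.

WHAT IS KEYED / IN THE TREE.  N44 (`WedgeHankelRecurrenceCensus`, p10 g28 claim #2 = № 326): `seqOf`, `seqOf_apply_of_lt`, `ncard_setOf_level_succ_eq_sum`, the fibres
`ncard_setOf_isAffineClass_snoc_of_isAffineClass ∕ _of_not_isAffineClass`, `ncard_setOf_isPolarClass_snoc_of_isAffineClass ∕ _of_isPolarClass ∕ _of_rank_ne`,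
`ncard_setOf_rank_half_eq_zero`; N43 (№ 323): `IsAffineClass`, `IsPolarClass`, `isAffineClass_or_isPolarClass`, `IsAffineClass.not_isPolarClass`, `not_isPolarClass_zero`.
Mathlib: `Fin.snoc`, `Fin.castLE`, `Finset.card_filter`, `Finset.sum_range_succ'`, `Finset.card_eq_sum_card_fiberwise`, `Set.ncard_coe_finset`, `Matrix.rank_le_height`.
THIS FILE (namespace `Summit.Ventures.HSemireg.Wedge.HankelOuter` continued; CHAINED on N44; 1 definition `prefixOf`):
* §557 the prefix `prefixOf K k v = (v_0, …, v_{k−1})` (`0`-padded if `k > N + 1`); `prefixOf_snoc` (a new last coefficient does not change it, `k ≤ N + 1`); **`ncard_setOf_prefixOf`** (`s^{N+1−k}` classes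
  with a given prefix, `k ≤ N + 1`).
* §558 the census recursions WITH PREFIX (same fibres, N44 §545): `ncard_setOf_prefixOf_isAffineClass_level_succ` (`A_{N+1}(r) = A_N(r)`), `ncard_setOf_prefixOf_isPolarClass_level_succ`
  (`P_{N+1}(d+1) = (s−1)·A_N(d) + s·P_N(d)`), `ncard_setOf_prefixOf_rank_eq_add` (`T = A + P`), `ncard_setOf_prefixOf_isPolarClass_zero`, `ncard_setOf_prefixOf_rank_le_eq_sum` (`#{R ≤ r} = Σ_{r′ ≤ r} T(r′)`),
  `ncard_setOf_prefixOf_rank_le_of_top` (at level `2t + 1` every class has `R ≤ t + 1`).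
* §559 THE TWO IDENTITIES: **`ncard_setOf_prefixOf_rank_le_level_succ_eq`** (`#{R^{N+1} ≤ r} = A_N(r) + s·#{R^N ≤ r − 1}`, `1 ≤ r`, `2r ≤ N + 1`), **`ncard_setOf_prefixOf_isPolarClass_eq`**
  (`P_N(r) = (s − 1)·#{R^N ≤ r − 1}` for `1 ≤ r`, `2r ≤ N + 1`, `r + k ≤ N + 1` — by descent on `r`), hence **`ncard_setOf_prefixOf_rank_le_level_succ`** (`#{R^{N+1} ≤ r} = #{R^N ≤ r}` under the
  same hypotheses: the cumulative count is STATIONARY in the level).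
* §560 **`ncard_setOf_prefixOf_rank_half_le`** (THEOREM: `k ≤ r`, `2r ≤ N + 1 ⇒ #{v : prefixOf v = a, R^N(v) ≤ r} = s^{2r−k}`), **`ncard_setOf_prefixOf_rank_half_eq`** (`k + 1 ≤ r`, `2r ≤ N + 1 ⇒
  #{prefixOf v = a, R^N(v) = r} = (s² − 1)·s^{2r−2−k}`, independent of `a`); at `r = k` the exact count depends on `a` (example in the docstring).
Nothing Ext-side.  New names only.
-/

open Module Polynomial
open scoped Matrix Polynomial

namespace Summit.Ventures.HSemireg.Wedge.HankelOuter

open Summit.Ventures.HSemireg.Wedge Summit.Ventures.HSemireg.Wedge.Hankel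

variable (K : Type*) [Field K] {N : ℕ}

/-! ## §557. Prefixes -/

/-- THE PREFIX of length `k` of a class on `[0, N]`: `(v_0, …, v_{k−1})` (padded by `0` beyond `N`). [definition of this file] -/
def prefixOf (k : ℕ) (v : Fin (N + 1) → K) : Fin k → K := fun i => if h : (i : ℕ) < N + 1 then v ⟨i, h⟩ else 0

/-- `prefixOf v i = v_i` for `i < N + 1`. -/
theorem prefixOf_apply_of_lt {k : ℕ} (v : Fin (N + 1) → K) (i : Fin k) (hi : (i : ℕ) < N + 1) : prefixOf K k v i = v ⟨i, hi⟩ := dif_pos hi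

/-- a new last coefficient does not change a prefix of length `k ≤ N + 1`. -/
theorem prefixOf_snoc {k : ℕ} (hk : k ≤ N + 1) (v : Fin (N + 1) → K) (x : K) : prefixOf K k (Fin.snoc v x : Fin (N + 1 + 1) → K) = prefixOf K k v := by
  funext i
  rw [prefixOf_apply_of_lt K _ i (by omega), prefixOf_apply_of_lt K _ i (by omega)]
  exact Fin.snoc_castSucc (α := fun _ => K) x v ⟨i, by omega⟩

omit [Field K] in
/-- counting by a filter (utility, private). -/
private theorem ncard_setOf_eq_card_filter' {α : Type*} [Fintype α] (P : α → Prop) [DecidablePred P] : {a | P a}.ncard = (Finset.univ.filter P).card := by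
  rw [← Finset.coe_filter_univ, Set.ncard_coe_finset]

/-- the whole class is its own prefix: exactly one class on `[0, N]` has a given prefix of length `N + 1`. -/
theorem ncard_setOf_prefixOf_self (a : Fin (N + 1) → K) : {v : Fin (N + 1) → K | prefixOf K (N + 1) v = a}.ncard = 1 := by
  have key : ∀ v : Fin (N + 1) → K, prefixOf K (N + 1) v = v := fun v => funext fun i => by rw [prefixOf_apply_of_lt K v i i.2]
  rw [Set.ncard_eq_one]
  exact ⟨a, Set.eq_singleton_iff_unique_mem.mpr ⟨key a, fun v hv => by rw [← key v]; exact hv⟩⟩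

/-- **`s^{N+1−k}` classes on `[0, N]` have a given prefix of length `k ≤ N + 1`.** -/
theorem ncard_setOf_prefixOf [Finite K] : ∀ {N k : ℕ}, k ≤ N + 1 → ∀ a : Fin k → K, {v : Fin (N + 1) → K | prefixOf K k v = a}.ncard = Nat.card K ^ (N + 1 - k)
  | 0, k, hk, a => by
    rcases Nat.eq_zero_or_pos k with rfl | hpos
    · have h : {v : Fin (0 + 1) → K | prefixOf K 0 v = a} = Set.univ := Set.eq_univ_of_forall fun v => funext fun i => i.elim0
      rw [h, Set.ncard_univ, Nat.card_fun, Nat.card_eq_fintype_card (α := Fin (0 + 1)), Fintype.card_fin, pow_one]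
    · obtain rfl : k = 0 + 1 := by omega
      rw [ncard_setOf_prefixOf_self, Nat.sub_self, pow_zero]
  | N + 1, k, hk, a => by
    classical
    haveI := Fintype.ofFinite K
    rcases Nat.lt_or_ge k (N + 1 + 1) with hlt | hge
    · rw [ncard_setOf_level_succ_eq_sum, show N + 1 + 1 - k = (N + 1 - k) + 1 by omega, pow_succ, ← ncard_setOf_prefixOf (show k ≤ N + 1 by omega) a, ncard_setOf_eq_card_filter',
        Finset.card_filter, Finset.sum_mul]
      refine Finset.sum_congr rfl fun v _ => ?_
      split_ifs with hv
      · rw [one_mul, ← Set.ncard_univ K]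
        exact congrArg Set.ncard (Set.eq_univ_of_forall fun x => by rw [Set.mem_setOf_eq, prefixOf_snoc K (by omega), hv])
      · rw [zero_mul, ← Set.ncard_empty (α := K)]
        exact congrArg Set.ncard (Set.eq_empty_iff_forall_notMem.mpr fun x hx => hv (by rwa [Set.mem_setOf_eq, prefixOf_snoc K (by omega)] at hx))
    · obtain rfl : k = N + 1 + 1 := by omega
      rw [ncard_setOf_prefixOf_self, Nat.sub_self, pow_zero]

/-! ## §558. The census recursions with a prescribed prefix (the fibres of N44 are pointwise) -/

section Prefix

variable [Finite K] {k : ℕ} (a : Fin k → K)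

/-- **`A_{N+1}(r; a) = A_N(r; a)`** (`2r ≤ N + 1`, `k ≤ N + 1`). -/
theorem ncard_setOf_prefixOf_isAffineClass_level_succ (hk : k ≤ N + 1) {r : ℕ} (h2 : r + r ≤ N + 1) :
    {w : Fin (N + 1 + 1) → K | prefixOf K k w = a ∧ IsAffineClass K (N + 1) r (seqOf K w)}.ncard = {v : Fin (N + 1) → K | prefixOf K k v = a ∧ IsAffineClass K N r (seqOf K v)}.ncard := by
  classical
  haveI := Fintype.ofFinite K
  rw [ncard_setOf_level_succ_eq_sum, ncard_setOf_eq_card_filter', Finset.card_filter]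
  refine Finset.sum_congr rfl fun v _ => ?_
  simp only [prefixOf_snoc K hk]
  by_cases hv : prefixOf K k v = a
  · simp only [hv, true_and]
    split_ifs with hA
    · exact ncard_setOf_isAffineClass_snoc_of_isAffineClass K v h2 hA
    · exact ncard_setOf_isAffineClass_snoc_of_not_isAffineClass K v h2 hA
  · simp only [hv, false_and, Set.setOf_false, Set.ncard_empty, if_false]

/-- **`P_{N+1}(d+1; a) = (s − 1)·A_N(d; a) + s·P_N(d; a)`** (`2d ≤ N`, `k ≤ N + 1`). -/
theorem ncard_setOf_prefixOf_isPolarClass_level_succ (hk : k ≤ N + 1) {d : ℕ} (h2 : d + d ≤ N) :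
    {w : Fin (N + 1 + 1) → K | prefixOf K k w = a ∧ IsPolarClass K (N + 1) (d + 1) (seqOf K w)}.ncard
      = (Nat.card K - 1) * {v : Fin (N + 1) → K | prefixOf K k v = a ∧ IsAffineClass K N d (seqOf K v)}.ncard
        + Nat.card K * {v : Fin (N + 1) → K | prefixOf K k v = a ∧ IsPolarClass K N d (seqOf K v)}.ncard := by
  classical
  haveI := Fintype.ofFinite K
  rw [ncard_setOf_level_succ_eq_sum, ncard_setOf_eq_card_filter', ncard_setOf_eq_card_filter', Finset.card_filter, Finset.card_filter, Finset.mul_sum, Finset.mul_sum,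
    ← Finset.sum_add_distrib]
  refine Finset.sum_congr rfl fun v _ => ?_
  simp only [prefixOf_snoc K hk]
  by_cases hv : prefixOf K k v = a
  · simp only [hv, true_and]
    by_cases hA : IsAffineClass K N d (seqOf K v)
    · rw [if_pos hA, if_neg hA.not_isPolarClass, ncard_setOf_isPolarClass_snoc_of_isAffineClass K v h2 hA]; ring
    · by_cases hP : IsPolarClass K N d (seqOf K v)
      · rw [if_neg hA, if_pos hP, ncard_setOf_isPolarClass_snoc_of_isPolarClass K v h2 hP]; ring
      · have hq : (hankel1 K N (N / 2) (seqOf K v)).rank ≠ d := fun h => (isAffineClass_or_isPolarClass K h).elim hA hP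
        rw [if_neg hA, if_neg hP, ncard_setOf_isPolarClass_snoc_of_rank_ne K v h2 hq]; ring
  · simp only [hv, false_and, Set.setOf_false, Set.ncard_empty, if_false, mul_zero, add_zero]

/-- `T_N(r; a) = A_N(r; a) + P_N(r; a)`. -/
theorem ncard_setOf_prefixOf_rank_eq_add (N r : ℕ) :
    {v : Fin (N + 1) → K | prefixOf K k v = a ∧ (hankel1 K N (N / 2) (seqOf K v)).rank = r}.ncard
      = {v : Fin (N + 1) → K | prefixOf K k v = a ∧ IsAffineClass K N r (seqOf K v)}.ncard + {v : Fin (N + 1) → K | prefixOf K k v = a ∧ IsPolarClass K N r (seqOf K v)}.ncard := by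
  have hunion : {v : Fin (N + 1) → K | prefixOf K k v = a ∧ (hankel1 K N (N / 2) (seqOf K v)).rank = r}
      = {v : Fin (N + 1) → K | prefixOf K k v = a ∧ IsAffineClass K N r (seqOf K v)} ∪ {v : Fin (N + 1) → K | prefixOf K k v = a ∧ IsPolarClass K N r (seqOf K v)} := by
    ext v
    rw [Set.mem_setOf_eq, Set.mem_union, Set.mem_setOf_eq, Set.mem_setOf_eq]
    exact ⟨fun h => (isAffineClass_or_isPolarClass K h.2).elim (fun h' => Or.inl ⟨h.1, h'⟩) fun h' => Or.inr ⟨h.1, h'⟩,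
      fun h => h.elim (fun h => ⟨h.1, h.2.rank_eq⟩) fun h => ⟨h.1, h.2.rank_eq⟩⟩
  have hdisj : Disjoint {v : Fin (N + 1) → K | prefixOf K k v = a ∧ IsAffineClass K N r (seqOf K v)} {v : Fin (N + 1) → K | prefixOf K k v = a ∧ IsPolarClass K N r (seqOf K v)} :=
    Set.disjoint_left.mpr fun v hA hP => IsAffineClass.not_isPolarClass hA.2 hP.2
  rw [hunion, Set.ncard_union_eq hdisj (Set.toFinite _) (Set.toFinite _)]

omit [Finite K] in
/-- `P_N(0; a) = 0`. -/
theorem ncard_setOf_prefixOf_isPolarClass_zero (N : ℕ) : {v : Fin (N + 1) → K | prefixOf K k v = a ∧ IsPolarClass K N 0 (seqOf K v)}.ncard = 0 := by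
  have he : {v : Fin (N + 1) → K | prefixOf K k v = a ∧ IsPolarClass K N 0 (seqOf K v)} = ∅ := Set.eq_empty_iff_forall_notMem.mpr fun v hv => not_isPolarClass_zero K _ hv.2
  rw [he, Set.ncard_empty]

/-- `#{prefixOf = a, R^N ≤ r} = Σ_{r′ ≤ r} T_N(r′; a)`. -/
theorem ncard_setOf_prefixOf_rank_le_eq_sum (N r : ℕ) :
    {v : Fin (N + 1) → K | prefixOf K k v = a ∧ (hankel1 K N (N / 2) (seqOf K v)).rank ≤ r}.ncard
      = ∑ r' ∈ Finset.range (r + 1), {v : Fin (N + 1) → K | prefixOf K k v = a ∧ (hankel1 K N (N / 2) (seqOf K v)).rank = r'}.ncard := by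
  classical
  haveI := Fintype.ofFinite K
  have hmaps : ((Finset.univ.filter fun v : Fin (N + 1) → K => prefixOf K k v = a ∧ (hankel1 K N (N / 2) (seqOf K v)).rank ≤ r : Finset (Fin (N + 1) → K)) :
      Set (Fin (N + 1) → K)).MapsTo (fun v => (hankel1 K N (N / 2) (seqOf K v)).rank) (Finset.range (r + 1) : Finset ℕ) := fun v hv =>
    Finset.mem_coe.mpr (Finset.mem_range.mpr (Nat.lt_succ_of_le (Finset.mem_filter.mp (Finset.mem_coe.mp hv)).2.2))
  rw [ncard_setOf_eq_card_filter', Finset.card_eq_sum_card_fiberwise hmaps]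
  refine Finset.sum_congr rfl fun r' hr' => ?_
  rw [ncard_setOf_eq_card_filter', Finset.filter_filter]
  congr 1
  exact Finset.filter_congr fun v _ => ⟨fun h => ⟨h.1.1, h.2⟩, fun h => ⟨⟨h.1, by have := Finset.mem_range.mp hr'; omega⟩, h.2⟩⟩

/-- at the odd level `2t + 1` every class has `R ≤ t + 1`: `#{prefixOf = a, R^{2t+1} ≤ t + 1} = s^{2t+2−k}` (`k ≤ 2t + 2`). -/
theorem ncard_setOf_prefixOf_rank_le_of_top {t : ℕ} (hk : k ≤ 2 * t + 1 + 1) :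
    {v : Fin (2 * t + 1 + 1) → K | prefixOf K k v = a ∧ (hankel1 K (2 * t + 1) ((2 * t + 1) / 2) (seqOf K v)).rank ≤ t + 1}.ncard = Nat.card K ^ (2 * t + 1 + 1 - k) := by
  rw [← ncard_setOf_prefixOf K hk a]
  congr 1
  ext v
  rw [Set.mem_setOf_eq, Set.mem_setOf_eq]
  have h : (hankel1 K (2 * t + 1) ((2 * t + 1) / 2) (seqOf K v)).rank ≤ (2 * t + 1) / 2 + 1 := Matrix.rank_le_height _
  exact ⟨fun h' => h'.1, fun h' => ⟨h', by omega⟩⟩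

/-! ## §559. The two identities: one more level, and the polar classes against the classes of smaller rank -/

/-- **ONE MORE LEVEL: `#{prefixOf = a, R^{N+1} ≤ r} = A_N(r; a) + s·#{prefixOf = a, R^N ≤ r − 1}`** (`1 ≤ r`, `2r ≤ N + 1`, `k ≤ N + 1`; sum the recursions of §558 over the ranks `≤ r`). -/
theorem ncard_setOf_prefixOf_rank_le_level_succ_eq (hk : k ≤ N + 1) {r : ℕ} (hr : 1 ≤ r) (h2 : r + r ≤ N + 1) :
    {w : Fin (N + 1 + 1) → K | prefixOf K k w = a ∧ (hankel1 K (N + 1) ((N + 1) / 2) (seqOf K w)).rank ≤ r}.ncard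
      = {v : Fin (N + 1) → K | prefixOf K k v = a ∧ IsAffineClass K N r (seqOf K v)}.ncard
        + Nat.card K * {v : Fin (N + 1) → K | prefixOf K k v = a ∧ (hankel1 K N (N / 2) (seqOf K v)).rank ≤ r - 1}.ncard := by
  obtain ⟨d, rfl⟩ : ∃ d, r = d + 1 := ⟨r - 1, by omega⟩
  rw [Nat.add_sub_cancel, ncard_setOf_prefixOf_rank_le_eq_sum, ncard_setOf_prefixOf_rank_le_eq_sum, Finset.mul_sum, Finset.sum_range_succ' _ (d + 1),
    Finset.sum_congr rfl fun r' hr' => by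
      rw [ncard_setOf_prefixOf_rank_eq_add, ncard_setOf_prefixOf_isAffineClass_level_succ K a hk (by have := Finset.mem_range.mp hr'; omega),
        ncard_setOf_prefixOf_isPolarClass_level_succ K a hk (by have := Finset.mem_range.mp hr'; omega)],
    ncard_setOf_prefixOf_rank_eq_add, ncard_setOf_prefixOf_isPolarClass_zero, add_zero, ncard_setOf_prefixOf_isAffineClass_level_succ K a hk (by omega)]
  -- regroup: Σ_{r′ ≤ d} [A(r′+1) + (s−1)A(r′) + sP(r′)] + A(0) = A(d+1) + Σ_{r′ ≤ d} s(A(r′) + P(r′))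
  have hs : 1 ≤ Nat.card K := (Finite.one_lt_card (α := K)).le
  have key : ∀ n : ℕ, (∑ r' ∈ Finset.range n, ({v : Fin (N + 1) → K | prefixOf K k v = a ∧ IsAffineClass K N (r' + 1) (seqOf K v)}.ncard
      + ((Nat.card K - 1) * {v : Fin (N + 1) → K | prefixOf K k v = a ∧ IsAffineClass K N r' (seqOf K v)}.ncard
        + Nat.card K * {v : Fin (N + 1) → K | prefixOf K k v = a ∧ IsPolarClass K N r' (seqOf K v)}.ncard)))
      + {v : Fin (N + 1) → K | prefixOf K k v = a ∧ IsAffineClass K N 0 (seqOf K v)}.ncard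
      = {v : Fin (N + 1) → K | prefixOf K k v = a ∧ IsAffineClass K N n (seqOf K v)}.ncard
        + ∑ r' ∈ Finset.range n, Nat.card K * {v : Fin (N + 1) → K | prefixOf K k v = a ∧ (hankel1 K N (N / 2) (seqOf K v)).rank = r'}.ncard := by
    intro n
    induction n with
    | zero => simp
    | succ n ih =>
      rw [Finset.sum_range_succ, add_right_comm, ih, Finset.sum_range_succ, ncard_setOf_prefixOf_rank_eq_add K a N n]
      obtain ⟨u, hu⟩ := Nat.exists_eq_add_of_le' hs
      rw [hu, Nat.add_sub_cancel]
      ring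
  rw [key (d + 1)]

/-- **THE POLAR CLASSES AGAINST THE CLASSES OF SMALLER RANK: `P_N(r; a) = (s − 1)·#{prefixOf = a, R^N ≤ r − 1}`** for `1 ≤ r`, `2r ≤ N + 1` and `r + k ≤ N + 1` — by descent on `r`
(`P_{N+1}(d+1) = (s−1)A_N(d) + sP_N(d)` and the previous identity; at `r = 1`: `P_N(1) = (s−1)·A_{N−1}(0) = (s−1)·T_N(0)`).  For `r + k > N + 1` it fails (the prefix is felt). -/
theorem ncard_setOf_prefixOf_isPolarClass_eq : ∀ {N : ℕ} {r : ℕ}, 1 ≤ r → r + r ≤ N + 1 → r + k ≤ N + 1 →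
    {v : Fin (N + 1) → K | prefixOf K k v = a ∧ IsPolarClass K N r (seqOf K v)}.ncard
      = (Nat.card K - 1) * {v : Fin (N + 1) → K | prefixOf K k v = a ∧ (hankel1 K N (N / 2) (seqOf K v)).rank ≤ r - 1}.ncard
  | 0, r, hr, h2, _ => by omega
  | N + 1, r, hr, h2, hrk => by
    obtain ⟨d, rfl⟩ : ∃ d, r = d + 1 := ⟨r - 1, by omega⟩
    rw [Nat.add_sub_cancel, ncard_setOf_prefixOf_isPolarClass_level_succ K a (by omega) (by omega)]
    rcases Nat.eq_zero_or_pos d with rfl | hd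
    · -- `P_{N+1}(1) = (s−1)·A_N(0)` and `#{R^{N+1} ≤ 0} = T_{N+1}(0) = A_{N+1}(0) = A_N(0)`
      rw [ncard_setOf_prefixOf_isPolarClass_zero, mul_zero, add_zero, ncard_setOf_prefixOf_rank_le_eq_sum, Finset.sum_range_one, ncard_setOf_prefixOf_rank_eq_add,
        ncard_setOf_prefixOf_isPolarClass_zero, add_zero, ncard_setOf_prefixOf_isAffineClass_level_succ K a (by omega) (by omega)]
    · rw [ncard_setOf_prefixOf_isPolarClass_eq hd (by omega) (by omega), ncard_setOf_prefixOf_rank_le_level_succ_eq K a (by omega) hd (by omega)]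
      obtain ⟨u, hu⟩ := Nat.exists_eq_add_of_le' (Finite.one_lt_card (α := K)).le
      rw [hu, Nat.add_sub_cancel]
      ring

/-- **THE CUMULATIVE COUNT IS STATIONARY IN THE LEVEL: `#{prefixOf = a, R^{N+1} ≤ r} = #{prefixOf = a, R^N ≤ r}`** for `2r ≤ N + 1` and `r + k ≤ N + 1`. -/
theorem ncard_setOf_prefixOf_rank_le_level_succ {r : ℕ} (h2 : r + r ≤ N + 1) (hrk : r + k ≤ N + 1) :
    {w : Fin (N + 1 + 1) → K | prefixOf K k w = a ∧ (hankel1 K (N + 1) ((N + 1) / 2) (seqOf K w)).rank ≤ r}.ncard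
      = {v : Fin (N + 1) → K | prefixOf K k v = a ∧ (hankel1 K N (N / 2) (seqOf K v)).rank ≤ r}.ncard := by
  rcases Nat.eq_zero_or_pos r with rfl | hr
  · rw [ncard_setOf_prefixOf_rank_le_eq_sum, ncard_setOf_prefixOf_rank_le_eq_sum, Finset.sum_range_one, Finset.sum_range_one, ncard_setOf_prefixOf_rank_eq_add, ncard_setOf_prefixOf_rank_eq_add,
      ncard_setOf_prefixOf_isPolarClass_zero, ncard_setOf_prefixOf_isPolarClass_zero, ncard_setOf_prefixOf_isAffineClass_level_succ K a (by omega) (by omega)]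
  · obtain ⟨d, rfl⟩ : ∃ d, r = d + 1 := ⟨r - 1, by omega⟩
    rw [ncard_setOf_prefixOf_rank_le_level_succ_eq K a (by omega) hr h2, Nat.add_sub_cancel]
    conv_rhs => rw [ncard_setOf_prefixOf_rank_le_eq_sum, Finset.sum_range_succ, ← ncard_setOf_prefixOf_rank_le_eq_sum, ncard_setOf_prefixOf_rank_eq_add,
      ncard_setOf_prefixOf_isPolarClass_eq K a hr h2 hrk, Nat.add_sub_cancel]
    obtain ⟨u, hu⟩ := Nat.exists_eq_add_of_le' (Finite.one_lt_card (α := K)).le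
    rw [hu, Nat.add_sub_cancel]
    ring

end Prefix

/-! ## §560. The census with a prescribed prefix -/

/-- **THE CENSUS WITH A PRESCRIBED PREFIX (Dwivedi–Grinberg's Theorem 2, re-derived): over a finite field with `s` elements, for `k ≤ r` and `2r ≤ N + 1`, exactly `s^{2r−k}` of
the classes `v` on `[0, N]` with `(v_0, …, v_{k−1}) = a` have middle rank `R^N(v) ≤ r` — for every prefix `a`.**  (At level `2r − 1` this is every class with the prefix; the count
is stationary above it by §559.) -/
theorem ncard_setOf_prefixOf_rank_half_le [Finite K] {k r : ℕ} (hkr : k ≤ r) (h2 : r + r ≤ N + 1) (a : Fin k → K) :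
    {v : Fin (N + 1) → K | prefixOf K k v = a ∧ (hankel1 K N (N / 2) (seqOf K v)).rank ≤ r}.ncard = Nat.card K ^ (2 * r - k) := by
  rcases Nat.eq_zero_or_pos r with rfl | hr
  · obtain rfl : k = 0 := by omega
    rw [Nat.sub_zero, mul_zero, pow_zero]
    refine Eq.trans ?_ (ncard_setOf_rank_half_eq_zero K N)
    congr 1
    ext v
    exact ⟨fun h => Nat.le_zero.mp h.2, fun h => ⟨funext fun i => i.elim0, le_of_eq h⟩⟩
  · obtain ⟨j, rfl⟩ : ∃ j, N = r + r - 1 + j := ⟨N - (r + r - 1), by omega⟩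
    induction j with
    | zero =>
      obtain ⟨t, rfl⟩ : ∃ t, r = t + 1 := ⟨r - 1, by omega⟩
      rw [show t + 1 + (t + 1) - 1 + 0 = 2 * t + 1 by omega, show 2 * (t + 1) - k = 2 * t + 1 + 1 - k by omega]
      exact ncard_setOf_prefixOf_rank_le_of_top K a (by omega)
    | succ j ih =>
      rw [show r + r - 1 + (j + 1) = r + r - 1 + j + 1 by omega, ncard_setOf_prefixOf_rank_le_level_succ K a (by omega) (by omega)]
      exact ih (by omega)

/-- **… hence for `k + 1 ≤ r`, `2r ≤ N + 1` exactly `(s² − 1)·s^{2r−2−k}` classes with the prefix `a` have `R^N = r`, again independently of `a`** (at `r = k` the exact count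
does depend on `a`: for `k = 2`, `a = (0, 1)` no class with this prefix has `R ≤ 1` beyond level `1`, for `a = (0, 0)` there are `s`). -/
theorem ncard_setOf_prefixOf_rank_half_eq [Finite K] {k r : ℕ} (hkr : k + 1 ≤ r) (h2 : r + r ≤ N + 1) (a : Fin k → K) :
    {v : Fin (N + 1) → K | prefixOf K k v = a ∧ (hankel1 K N (N / 2) (seqOf K v)).rank = r}.ncard = (Nat.card K ^ 2 - 1) * Nat.card K ^ (2 * r - 2 - k) := by
  obtain ⟨d, rfl⟩ : ∃ d, r = d + 1 := ⟨r - 1, by omega⟩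
  have h1 := ncard_setOf_prefixOf_rank_half_le K (show k ≤ d + 1 by omega) h2 a
  have h0 := ncard_setOf_prefixOf_rank_half_le K (show k ≤ d by omega) (show d + d ≤ N + 1 by omega) a
  rw [ncard_setOf_prefixOf_rank_le_eq_sum, Finset.sum_range_succ, ← ncard_setOf_prefixOf_rank_le_eq_sum, h0] at h1
  rw [show 2 * (d + 1) - 2 - k = 2 * d - k by omega, Nat.sub_mul, one_mul, ← pow_add, show 2 + (2 * d - k) = 2 * (d + 1) - k by omega]
  omega

/-- **EVERY SHAPE (the printed form of Dwivedi–Grinberg's Theorem 2): for `k′ ≤ N`, `h = min(k′ + 1, N + 1 − k′)` the smaller side of the `(k′+1) × (N+1−k′)` Hankel matrix `H^N_{k′}`,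
`k ≤ r < h` and every prefix `a` of length `k`, exactly `s^{2r−k}` classes `v` on `[0, N]` with prefix `a` have `rank H^N_{k′}(v) ≤ r`** (N15: `rank H^N_{k′} = min(h, R^N)`). -/
theorem ncard_setOf_prefixOf_rank_hankel1_le [Finite K] {k r k' : ℕ} (hk' : k' ≤ N) (hkr : k ≤ r) (hrh : r < min (k' + 1) (N + 1 - k')) (a : Fin k → K) :
    {v : Fin (N + 1) → K | prefixOf K k v = a ∧ (hankel1 K N k' (seqOf K v)).rank ≤ r}.ncard = Nat.card K ^ (2 * r - k) := by
  rw [← ncard_setOf_prefixOf_rank_half_le K (N := N) hkr (by have := min_le_left (k' + 1) (N + 1 - k'); have := min_le_right (k' + 1) (N + 1 - k'); omega) a]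
  congr 1
  ext v
  rw [Set.mem_setOf_eq, Set.mem_setOf_eq, rank_hankel1_eq_min K hk']
  refine and_congr_right fun _ => ⟨fun h => ?_, fun h => (min_le_right _ _).trans h⟩
  rcases le_total (min (k' + 1) (N + 1 - k')) ((hankel1 K N (N / 2) (seqOf K v)).rank) with hle | hle
  · rw [min_eq_left hle] at h; omega
  · rwa [min_eq_right hle] at h

end Summit.Ventures.HSemireg.Wedge.HankelOuter
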